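import Mathlib
import Summits.AtomisticToContinuum.HydrodynamicLimit.Theorems.ImplosionDichotomyDenseExcursionCavityUniformDeepRows

/-!
# The deep zone of the energy regime, II: deep-zone facts and the frozen variable `V = e^{2x}Sŝ` (any `Re Λ`, `‖Λ‖ ≥ 48`)
# (crux `DenseExcursion`, line `sonic-cavity-renewal`, bricks for stub `stub_cavityResolventCk`, theorem T7(iii))

Helper file (`--supports stmt-AtomisticToContinuum-12586`, line lead a2, stub-worker E3 for `stub_cavityResolventCk`,
energy regime `Re Λ → +∞`).

**Mathematics.** On the deep zone `x ≤ x_d`, `8‖Λ‖e^{x_d} = 1` (`deep_facts`: `S ≥ 268`, `(7/10)e^{−x} ≤ S ≤ e^{−x}`,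
`‖Λ‖ ≤ S`, envelope), given sup bounds `‖V‖ ≤ V_s`, `‖ŵ‖ ≤ U` there, the `V`-row bound of `deep_V_row_bound` reads
`‖V′‖ ≤ e^{2x}(3‖Λ‖V_s + ‖Λ‖U/2 + 3N)` (`deep_V_deriv`), so by derivative comparison run leftward from `x_d`
(`image_norm_le_of_norm_deriv_right_le_deriv_boundary`) `V` IS FROZEN:
`‖V(x′) − V(x_d)‖ ≤ (3‖Λ‖V_s + ‖Λ‖U/2 + 3N)·e^{2x_d}/2` for `x′ ≤ x_d` (`deep_V_frozen`, registered) — the regular-perturbation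
half of the spherical-Bessel inner problem, with `e^{2x_d} = 1/(64‖Λ‖²)`.
Sources: folklore. NOT here: the `u`-row closure and the deep-zone bound (next file of worker E3).
-/

noncomputable section

open Filter Set
open scoped Topology ContDiff

namespace Summit.AtomisticToContinuum.HydrodynamicLimit.Theorems.SonicCavityRenewal

open Summit.AtomisticToContinuum.HydrodynamicLimit.Theorems.R2OneModeTwoConditions

/-! ## Deep-zone facts -/

/-- THE DEEP-ZONE FACTS about the profile at a point `y ≤ x_d`, `8‖Λ‖e^{x_d} = 1`, `‖Λ‖ ≥ 48` (any `Re Λ`): `y ≤ 1`, `S ≥ 268`,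
`(7/10)e^{−y} ≤ S ≤ e^{−y}`, `7/10 ≤ eʸS ≤ 1`, `‖Λ‖ ≤ S`, the envelope `|W| ≤ 1/4`, `|W′| ≤ 1/2`, `|S + S′| ≤ 5/8`.
[folklore] -/
theorem deep_facts {r : ℝ} {W S : ℝ → ℝ} (hT : CavityTube r W S) {Λ : ℂ} {xd : ℝ} (hL : 48 ≤ ‖Λ‖)
    (hxd : 8 * ‖Λ‖ * Real.exp xd = 1) {y : ℝ} (hy : y ≤ xd) :
    y ≤ 1 ∧ 268 ≤ S y ∧ 7 / 10 * Real.exp (-y) ≤ S y ∧ S y ≤ Real.exp (-y) ∧ 7 / 10 ≤ Real.exp y * S y ∧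
      Real.exp y * S y ≤ 1 ∧ Real.exp y * Real.exp (-y) = 1 ∧ ‖Λ‖ ≤ S y ∧ |W y| ≤ 1 / 4 ∧ |deriv W y| ≤ 1 / 2 ∧
      |S y + deriv S y| ≤ 5 / 8 := by
  obtain ⟨-, -, -, -, -, -, hang, hWenv, hSenv, -⟩ := hT
  have hLpos : 0 < ‖Λ‖ := by linarith
  have hexd : Real.exp xd = 1 / (8 * ‖Λ‖) := by field_simp; linarith
  have hey : Real.exp y ≤ 1 / (8 * ‖Λ‖) := by rw [← hexd]; exact Real.exp_le_exp.mpr hy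
  have hinv : Real.exp y * Real.exp (-y) = 1 := by rw [← Real.exp_add, add_neg_cancel, Real.exp_zero]
  have h8L : 8 * ‖Λ‖ ≤ Real.exp (-y) := by
    have h1 : 8 * ‖Λ‖ * Real.exp y ≤ 8 * ‖Λ‖ * (1 / (8 * ‖Λ‖)) := mul_le_mul_of_nonneg_left hey (by positivity)
    rw [mul_one_div_cancel (by positivity)] at h1
    have h2 := mul_le_mul_of_nonneg_right h1 (Real.exp_pos (-y)).le
    rwa [mul_assoc, hinv, mul_one, one_mul] at h2
  have hy1 : y ≤ 1 := by
    by_contra h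
    push Not at h
    have h2 : Real.exp (-y) < Real.exp 0 := Real.exp_lt_exp.mpr (by linarith)
    rw [Real.exp_zero] at h2
    linarith
  obtain ⟨h7, h1, -, -⟩ := hSenv y hy1
  obtain ⟨hWy, hW'y, -⟩ := hWenv y hy1
  have hepos : 0 < Real.exp (-y) := Real.exp_pos _
  have hSe : S y ≤ Real.exp (-y) := by
    have := mul_le_mul_of_nonneg_left h1 hepos.le
    rwa [← mul_assoc, mul_comm (Real.exp (-y)) (Real.exp y), hinv, one_mul, mul_one] at this
  have hS7 : 7 / 10 * Real.exp (-y) ≤ S y := by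
    have := mul_le_mul_of_nonneg_left h7 hepos.le
    rwa [← mul_assoc, mul_comm (Real.exp (-y)) (Real.exp y), hinv, one_mul, mul_comm] at this
  have hσ : |S y + deriv S y| ≤ 5 / 8 := by
    have h := hang y hy1
    obtain ⟨h₁, h₂⟩ := abs_le.mp hWy
    exact abs_le.mpr ⟨by linarith [neg_abs_le (S y + deriv S y)], by linarith [le_abs_self (S y + deriv S y)]⟩
  exact ⟨hy1, by linarith, hS7, hSe, h7, h1, hinv, by linarith, hWy, hW'y, hσ⟩

/-- The norm of `V = e^{2y}Sŝ`: `‖V‖ = eʸ·(eʸS)·‖ŝ‖` (`S > 0`). [folklore] -/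
theorem norm_V_eq {S : ℝ → ℝ} (hSpos : ∀ x, 0 < S x) (ŝ : ℝ → ℂ) (y : ℝ) :
    ‖((Real.exp (2 * y) * S y : ℝ) : ℂ) * ŝ y‖ = Real.exp y * (Real.exp y * S y) * ‖ŝ y‖ := by
  have h : ‖((Real.exp (2 * y) * S y : ℝ) : ℂ) * ŝ y‖ = |Real.exp (2 * y) * S y| * ‖ŝ y‖ := by
    rw [norm_mul, Complex.norm_real, Real.norm_eq_abs]
  rw [h, abs_of_pos (mul_pos (Real.exp_pos _) (hSpos y)), show (2 : ℝ) * y = y + y by ring, Real.exp_add]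
  ring

/-! ## `V` is frozen across the deep zone -/

/-- THE DERIVATIVE OF `V = e^{2y}Sŝ` AND ITS BOUND on the deep zone: `V′ = e^{2y}(2S + S′)ŝ + e^{2y}Sŝ′` and, given sup
bounds `‖V‖ ≤ V_s`, `‖ŵ‖ ≤ U` on `y ≤ x_d`, `‖V′(y)‖ ≤ e^{2y}(3‖Λ‖V_s + ‖Λ‖U/2 + 3N)` there (`deep_V_row_bound`). [folklore] -/
theorem deep_V_deriv {r : ℝ} {W S : ℝ → ℝ} (hP : IsMonatomicProfile r W S) (hT : CavityTube r W S) {Λ : ℂ}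
    {f g ŵ ŝ : ℝ → ℂ} {N xd Vs U : ℝ} (hL : 48 ≤ ‖Λ‖) (hŝ : Differentiable ℝ ŝ)
    (hsol : ∀ x, x ≤ 1 → Λ * ŵ x - linW r W S ŵ ŝ x = f x ∧ Λ * ŝ x - linS r W S ŵ ŝ x = g x)
    (hsrc : ∀ x, x ≤ 1 → ‖f x‖ + Real.exp x * ‖g x‖ ≤ N) (hxd : 8 * ‖Λ‖ * Real.exp xd = 1)
    (hVs : ∀ y, y ≤ xd → ‖((Real.exp (2 * y) * S y : ℝ) : ℂ) * ŝ y‖ ≤ Vs) (hU : ∀ y, y ≤ xd → ‖ŵ y‖ ≤ U)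
    (y : ℝ) :
    HasDerivAt (fun y => ((Real.exp (2 * y) * S y : ℝ) : ℂ) * ŝ y)
      (((Real.exp (2 * y) * (2 * S y + deriv S y) : ℝ) : ℂ) * ŝ y + ((Real.exp (2 * y) * S y : ℝ) : ℂ) * deriv ŝ y) y ∧
    (y ≤ xd → ‖((Real.exp (2 * y) * (2 * S y + deriv S y) : ℝ) : ℂ) * ŝ y +
        ((Real.exp (2 * y) * S y : ℝ) : ℂ) * deriv ŝ y‖ ≤ Real.exp (2 * y) * (3 * ‖Λ‖ * Vs + ‖Λ‖ / 2 * U + 3 * N)) := by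
  obtain ⟨hr, hr3, hW, hS, hSpos, -⟩ := hP
  have hS1 : Differentiable ℝ S := hS.differentiable (by simp)
  have hr2 : r < 2 := by
    have h13 : (1 : ℝ) < Real.sqrt 3 := (Real.lt_sqrt (by norm_num)).mpr (by norm_num)
    linarith
  constructor
  · have he2 : HasDerivAt (fun y => Real.exp (2 * y)) (Real.exp (2 * y) * 2) y := by
      simpa using ((hasDerivAt_id y).const_mul 2).exp
    have h1 := (he2.fun_mul (hS1 y).hasDerivAt).ofReal_comp
    have h2 := h1.fun_mul (hŝ y).hasDerivAt
    refine h2.congr_deriv ?_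
    push_cast
    ring
  · intro hy
    obtain ⟨hy1, h268, hS7, hSe, hσ7, -, hinv, hLS, hWy, hW'y, hσ⟩ := deep_facts hT hL hxd hy
    have hN : 0 ≤ N := by
      have h := hsrc 0 (by norm_num)
      have : 0 ≤ ‖f 0‖ + Real.exp 0 * ‖g 0‖ := by positivity
      linarith
    have hfg := hsrc y hy1
    have hf0 : 0 ≤ ‖f y‖ := norm_nonneg _
    have hg0 : 0 ≤ ‖g y‖ := norm_nonneg _
    have hey : 0 < Real.exp y := Real.exp_pos y
    have hFn : ‖f y‖ ≤ N := by nlinarith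
    have hGn : ‖g y‖ ≤ N * Real.exp (-y) := by
      have h1 : Real.exp y * ‖g y‖ ≤ N := by linarith
      have h2 := mul_le_mul_of_nonneg_left h1 (Real.exp_pos (-y)).le
      rwa [← mul_assoc, mul_comm (Real.exp (-y)) (Real.exp y), hinv, one_mul, mul_comm] at h2
    have hE2 : Real.exp (2 * y) = Real.exp y ^ 2 := by rw [← Real.exp_nat_mul]; norm_num
    have hσ2 : 49 / 100 ≤ Real.exp (2 * y) * S y ^ 2 := by
      have h := pow_le_pow_left₀ (by norm_num) hσ7 2
      rw [mul_pow] at h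
      rw [hE2]
      linarith [show ((7 : ℝ) / 10) ^ 2 = 49 / 100 by norm_num]
    have heq := deep_V_row (hsol y hy1)
    have hb := deep_V_row_bound Λ (ŝ y) (ŵ y) (f y) (g y) _ r (W y) (deriv W y) (S y) (deriv S y)
      (Real.exp (-y)) (Real.exp (2 * y)) N hWy hW'y hσ hr hr2 h268 hS7 hσ2 (Real.exp_pos _) hL hN hFn hGn heq
    refine hb.trans (mul_le_mul_of_nonneg_left ?_ (Real.exp_pos _).le)
    have hVy : Real.exp (2 * y) * S y * ‖ŝ y‖ = ‖((Real.exp (2 * y) * S y : ℝ) : ℂ) * ŝ y‖ := by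
      rw [norm_V_eq hSpos ŝ y, hE2]; ring
    rw [hVy]
    have t1 := mul_le_mul_of_nonneg_left (hVs y hy) (by positivity : (0 : ℝ) ≤ 3 * ‖Λ‖)
    have t2 := mul_le_mul_of_nonneg_left (hU y hy) (by positivity : (0 : ℝ) ≤ ‖Λ‖ / 2)
    linarith

/-- **Registered helper `deep_V_frozen` (worker E3, theorem T7(iii) of `stub_cavityResolventCk`): `V` IS FROZEN ACROSS THE DEEP
ZONE:** `‖V(x′) − V(x_d)‖ ≤ (3‖Λ‖V_s + ‖Λ‖U/2 + 3N)·e^{2x_d}/2` for `x′ ≤ x_d` (derivative comparison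
`image_norm_le_of_norm_deriv_right_le_deriv_boundary` run leftward from `x_d`). [folklore] -/
theorem deep_V_frozen : ∀ (r : ℝ) (W S : ℝ → ℝ), IsMonatomicProfile r W S → CavityTube r W S → ∀ (Λ : ℂ) (f g ŵ ŝ : ℝ → ℂ) (N xd Vs U : ℝ), 48 ≤ ‖Λ‖ → Differentiable ℝ ŝ → (∀ x, x ≤ 1 → Λ * ŵ x - linW r W S ŵ ŝ x = f x ∧ Λ * ŝ x - linS r W S ŵ ŝ x = g x) → (∀ x, x ≤ 1 → ‖f x‖ + Real.exp x * ‖g x‖ ≤ N) → 8 * ‖Λ‖ * Real.exp xd = 1 → (∀ y, y ≤ xd → ‖((Real.exp (2 * y) * S y : ℝ) : ℂ) * ŝ y‖ ≤ Vs) → (∀ y, y ≤ xd → ‖ŵ y‖ ≤ U) → 0 ≤ Vs → 0 ≤ U → ∀ x', x' ≤ xd → ‖((Real.exp (2 * x') * S x' : ℝ) : ℂ) * ŝ x' - ((Real.exp (2 * xd) * S xd : ℝ) : ℂ) * ŝ xd‖ ≤ (3 * ‖Λ‖ * Vs + ‖Λ‖ / 2 * U + 3 * N) * Real.exp (2 *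 xd) / 2 := by
  intro r W S hP hT Λ f g ŵ ŝ N xd Vs U hL hŝ hsol hsrc hxd hVs hU hVs0 hU0 x' hx'
  have hD := fun y => deep_V_deriv hP hT hL hŝ hsol hsrc hxd hVs hU y
  have hN : 0 ≤ N := by
    have h := hsrc 0 (by norm_num)
    have : 0 ≤ ‖f 0‖ + Real.exp 0 * ‖g 0‖ := by positivity
    linarith
  set V : ℝ → ℂ := fun y => ((Real.exp (2 * y) * S y : ℝ) : ℂ) * ŝ y with hV
  set V' : ℝ → ℂ := fun y => ((Real.exp (2 * y) * (2 * S y + deriv S y) : ℝ) : ℂ) * ŝ y +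
    ((Real.exp (2 * y) * S y : ℝ) : ℂ) * deriv ŝ y with hV'
  set MV : ℝ := 3 * ‖Λ‖ * Vs + ‖Λ‖ / 2 * U + 3 * N with hMV
  have hMV0 : 0 ≤ MV := by positivity
  set Φ : ℝ → ℂ := fun t => V (xd - t) - V xd with hΦ
  set Bf : ℝ → ℝ := fun t => MV * (Real.exp (2 * xd) - Real.exp (2 * (xd - t))) / 2 with hBf
  have hΦd : ∀ t, HasDerivAt Φ ((-1 : ℝ) • V' (xd - t)) t := by
    intro t
    have hl : HasDerivAt (fun t : ℝ => xd - t) (-1) t := by simpa using (hasDerivAt_id t).const_sub xd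
    have h1 := (hD (xd - t)).1.scomp t hl
    exact h1.sub_const (V xd)
  have hBfd : ∀ t, HasDerivAt Bf (MV * Real.exp (2 * (xd - t))) t := by
    intro t
    have hl : HasDerivAt (fun t : ℝ => 2 * (xd - t)) (-2) t := by
      simpa using ((hasDerivAt_id t).const_sub xd).const_mul 2
    have h1 : HasDerivAt (fun t => Real.exp (2 * (xd - t))) (Real.exp (2 * (xd - t)) * -2) t := hl.exp
    have h2 := ((h1.const_sub (Real.exp (2 * xd))).const_mul MV).div_const 2
    refine h2.congr_deriv ?_
    ring
  have hcomp := image_norm_le_of_norm_deriv_right_le_deriv_boundary (f := Φ) (a := 0) (b := xd - x')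
    (fun t _ => (hΦd t).continuousAt.continuousWithinAt) (fun t _ => (hΦd t).hasDerivWithinAt)
    (by simp [hΦ, hBf]) hBfd
    (fun t ht => by
      rw [norm_smul, norm_neg, norm_one, one_mul]
      exact ((hD (xd - t)).2 (by linarith [ht.1])).trans_eq (mul_comm _ _))
  have h := hcomp (show xd - x' ∈ Icc 0 (xd - x') from ⟨by linarith, le_rfl⟩)
  simp only [hΦ, hBf, sub_sub_cancel] at h
  refine h.trans ?_
  have : 0 ≤ MV * Real.exp (2 * x') := by positivity
  linarith

end Summit.AtomisticToContinuum.HydrodynamicLimit.Theorems.SonicCavityRenewal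

end
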